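import Summits.RiemannHypothesis.RiemannHypothesis.Theorems.TiltedLandingLaw421R3RateBooksQ

/-! # TiltedLandingLaw421R3RateBooksQ1b — W-08 RATE^B BOOKS: §B.4

Continuation of `…R3RateBooksQ.lean` (C4 g28 rateBooksQ-v5 sha c107456c, split per gate lint ≤ 400 l).
§B.4 the (CA364) instance: far / consumption / approach classes.
RH NOT proved; 24774 OPEN. -/

namespace RhW08.SealSwapQ

open Complex
open RhIdea6.G17.W07C7 RhIdea6.G17.W07C7.Rev6 RhIdea6.G18.W07C8.Law421BirthS RhIdea6.G19.W07C11.Seam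
open RhIdea6.G20.W07C12.Frac RhIdea6.G20.W07C12.StColP RhW07.C12.FieldSplit RhIdea6.G21.W07C13.TentMax
open RhW07.C14.TwoSided RhW07.C14.Classes RhW07.C14.Lineage RhW07.C14.Booking
open RhW07.C13.Heredity RhIdea6.G22.W07C15pre.Injection RhW07.E3.Cell
open RhW07.E3.Lit
open RhW08.Round1 RhW08.StSwap RhW08.Round2 RhW08.QuadW
open RhW08.SealSwap (PBot)

/-- (T) §B.4 **FAR level**: some lowest band state `v` of level `j` sees no zero of `f⁽ʲ⁾` other than the pair `v, v̄` in its near window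
`|Re z − Re v| < R/2` (the `RemainderBox` near window, centred at the state — C2 ADD-6 / Seam03). -/
def FarLevelQ : LevelClass := fun η f x₀ s hmax R Hs B j =>
  ∃ v : ℂ, IsLowest StTrkDQ η f x₀ s hmax R Hs B j v ∧
    ∀ z : ℂ, iteratedDeriv j f z = 0 → |z.re - v.re| < R / 2 → z = v ∨ z = (starRingEnd ℂ) v

/-- (T) §B.4 **CONSUMPTION level**: the booked `3/2`-tent of the lowest band state is non-empty, i.e. the level is NOT in the exception class
`EmptyTrkDQ` (so, if charged, it injects: `injectedQ_succ_of_charged`). -/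
def ConsLevelQ : LevelClass := fun η f x₀ s hmax R Hs B j => ¬ EmptyTrkDQ η f x₀ s hmax R Hs B j

/-- (T) §B.4 **APPROACH level**: neither far nor consumption (charged, empty tent, a foreign zero in the near window). -/
def ApproachLevelQ : LevelClass := restClass FarLevelQ ConsLevelQ

/-- (T, OPEN) §B.4 (P2) books-side FAR LAW: the far charged levels, net of their own drops, cost at most `aF` (critic RESULT-16 chain:
`N_far ≤ η·D/s ≤ 2.4η²(y₀/s)² = 0.6(Hs/s)²` at `η = 1/2`; prover's form: `FarEnergyLawQ` below). -/
def FarLawQ (aF : Budget) : Prop := ClassLawQ FarLevelQ aF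

/-- (T, OPEN) §B.4 (C) CONSUMPTION LAW: consumption levels that are not far, net of drops, cost at most the credits drawn plus `aC`
(«injected ≤ companions consumed; T₀ᴿ + new entries billed to B»). -/
def ConsLawQ (aC : Budget) : Prop := CreditLawQ (diffClass ConsLevelQ FarLevelQ) aC

/-- (T, OPEN) §B.4 (P4) **APPROACH ALLOWANCE** — director (CA364): «on a legal frame the charged levels of the ⊥-lineage that are neither far-hover
nor consumption-paid number ≤ (Hs/s)² + 1 (+ the unused part of B)», net of their own signed drops; a per-lineage COUNT, not a one-step lemma. -/
def ApproachAllowanceQ (aA : Budget) : Prop := ClassLawQ ApproachLevelQ aA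

/-- §B.4 the director's candidate approach allowance `(Hs/s)² + 1`. -/
noncomputable def approachPurseQ : Budget := fun _ _ _ s _ _ Hs _ => (Hs / s) ^ 2 + 1

/-- §B.4 a far allowance proportional to the Jensen energy purse: `c·(Hs/s)²` (critic: `c = 0.6` at `η = 1/2`). -/
noncomputable def farPurseQ (c : ℝ) : Budget := fun _ _ _ s _ _ Hs _ => c * (Hs / s) ^ 2

/-- (T, OPEN) §B.4 (R2) the per-level **FAR-HOVER ENERGY LAW** (junk-free form, no division by `η`): across a charged far level the Jensen energy
`lowH²` drops by at least `(s/η)²` — «every charged far-regime level lowers `(η/s)²(Hs² − lowH²)` by ≥ 1» (C1 ADD-8 law; critic RESULT-16 (ii)–(iii)). -/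
def FarEnergyLawQ : Prop :=
  ∀ (η : ℝ) (f : ℂ → ℂ) (x₀ s hmax R Hs : ℝ) (B : ℕ), EngineHyps5 2 η f x₀ s hmax R Hs B →
    ∀ j : ℕ, Charged (PTrkSQ PBot) StTrkDQ ReadyR2 η f x₀ s hmax R Hs B j → FarLevelQ η f x₀ s hmax R Hs B j →
      s ^ 2 ≤ η ^ 2 * (lowH StTrkDQ η f x₀ s hmax R Hs B j ^ 2 - lowH StTrkDQ η f x₀ s hmax R Hs B (j + 1) ^ 2)

/-- ★ (K) §B.4 **THE CAPITAL CONDITION READ OFF** (what the engines must check per legal frame): `CapitalLawQ aF aC aA` iff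
`aF + aC + aA + T₀ᴿ ≤ (Hs/s)² + B + 1 + 4·(hmax − lowH 0)/s` — the allowances AND the level-0 tent share one purse. -/
theorem capitalLawQ_iff (aF aC aA : Budget) : CapitalLawQ aF aC aA ↔
    ∀ (η : ℝ) (f : ℂ → ℂ) (x₀ s hmax R Hs : ℝ) (B : ℕ), EngineHyps5 2 η f x₀ s hmax R Hs B →
      aF η f x₀ s hmax R Hs B + aC η f x₀ s hmax R Hs B + aA η f x₀ s hmax R Hs B + tentMeterTrkD (3 / 2) η f x₀ s hmax R Hs B 0
        ≤ (Hs / s) ^ 2 + (B : ℝ) + 1 + 4 * (hmax - lowH StTrkDQ η f x₀ s hmax R Hs B 0) / s := by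
  simp only [CapitalLawQ, slack0Q_eq]
  constructor
  · intro h η f x₀ s hmax R Hs B hE; have := h η f x₀ s hmax R Hs B hE; linarith
  · intro h η f x₀ s hmax R Hs B hE; have := h η f x₀ s hmax R Hs B hE; linarith

/-- ★★★ (K) §B.4 **THE (CA364) NODE**: `FarLawQ aF → ConsLawQ aC → ApproachAllowanceQ aA → CapitalLawQ aF aC aA → RestRateBotQ`
— WORDS-8c as a kernel theorem; the four hypotheses are the OPEN laws (P2), (C), (P4) and the capital fit. -/
theorem restRateBotQ_of_CA364 {aF aC aA : Budget}
    (hF : FarLawQ aF) (hC : ConsLawQ aC) (hA : ApproachAllowanceQ aA) (hcap : CapitalLawQ aF aC aA) : RestRateBotQ :=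
  restRateBotQ_of_threeBooks hF hC hA hcap

/-- ★★★ (K) §B.4 **… and with the first stub, the crux**: `RestSuccBotQ → FarLawQ aF → ConsLawQ aC → ApproachAllowanceQ aA → CapitalLawQ aF aC aA →
TiltedLandingLaw421` (`law421T_of_succ_rateQ`, #1022). -/
theorem law421_of_CA364 (hS : RestSuccBotQ) {aF aC aA : Budget}
    (hF : FarLawQ aF) (hC : ConsLawQ aC) (hA : ApproachAllowanceQ aA) (hcap : CapitalLawQ aF aC aA) :
    Summit.RiemannHypothesis.RiemannHypothesis.Theses.EarlyAppointments.TiltedLandingLaw421 :=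
  law421T_of_succ_rateQ hS (restRateBotQ_of_CA364 hF hC hA hcap)

/-- (K) §B.4 sanity / exactness: with the trivial classification (nothing far, every level «consumption») and allowances `0, S₀, 0` the node's
hypotheses are EQUIVALENT to `RestRateBotQ` — the (CA364) split is a refinement of the registered text, never stronger than needed in total. -/
theorem threeBooks_trivial_iff : RestRateBotQ ↔
    (ClassLawQ NoLevelsQ (farPurseQ 0) ∧ CreditLawQ (diffClass AllLevelsQ NoLevelsQ) slack0Q
      ∧ ClassLawQ (restClass NoLevelsQ AllLevelsQ) (farPurseQ 0) ∧ CapitalLawQ (farPurseQ 0) slack0Q (farPurseQ 0)) := by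
  constructor
  · intro h
    refine ⟨?_, ?_, ?_, ?_⟩
    · intro η f x₀ s hmax R Hs B hE k _
      rw [netCostQ_noLevels]; simp [farPurseQ]
    · intro η f x₀ s hmax R Hs B hE k hk
      have hall : netCostQ (diffClass AllLevelsQ NoLevelsQ) η f x₀ s hmax R Hs B (k + 1)
          = netCostQ AllLevelsQ η f x₀ s hmax R Hs B (k + 1) := by
        simp only [netCostQ, diffClass, AllLevelsQ, NoLevelsQ]
        refine Finset.sum_congr rfl fun j _ => ?_
        by_cases hC : Charged (PTrkSQ PBot) StTrkDQ ReadyR2 η f x₀ s hmax R Hs B j <;> simp [hC]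
      rw [hall]
      exact (restRateBotQ_iff_creditLaw_all.mp h) η f x₀ s hmax R Hs B hE k hk
    · intro η f x₀ s hmax R Hs B hE k _
      rw [netCostQ_eq_zero_of_forall_not (fun j _ _ => by simp [restClass, AllLevelsQ])]; simp [farPurseQ]
    · intro η f x₀ s hmax R Hs B hE; simp [farPurseQ]
  · rintro ⟨hF, hC, hA, hcap⟩
    exact restRateBotQ_of_threeBooks hF hC hA hcap

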